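import Mathlib
import Summits.Ventures.PercRepro2.K5HyperI

/-!
# THE `M-(i)` CERTIFICATES, PART 2
(blind cell PercRepro2, typer-1 g10; mine-1 §23.5 — the (i)-side; twin `k5hyper_i_typer.py`, `0` violations)

One `decide +kernel` per (triangle `T`, pair `e ⊆ T`): `CertLE (kNegMI (triMask T) (pairMask e)) (kPosMI …)` — `N⁽ⁱ⁾(H + T(1) + e(1)) ≥ N⁽ⁱ⁾(H + T(1))` at every `K₅` profile.
-/

namespace Summit.Ventures.PercRepro2

namespace K5

set_option maxRecDepth 100000 in
/-- `M-(i) ≥ 0` on the triangle `T = {0, 1, 4}`, pair `e = {0, 1}`. -/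
theorem cert_MI_014_01 :
    CertLE (kNegMI (triMask 0 1 4) (pairMask 0 1)) (kPosMI (triMask 0 1 4) (pairMask 0 1)) := by
  unfold CertLE
  decide +kernel

set_option maxRecDepth 100000 in
/-- `M-(i) ≥ 0` on the triangle `T = {0, 1, 4}`, pair `e = {0, 4}`. -/
theorem cert_MI_014_04 :
    CertLE (kNegMI (triMask 0 1 4) (pairMask 0 4)) (kPosMI (triMask 0 1 4) (pairMask 0 4)) := by
  unfold CertLE
  decide +kernel

set_option maxRecDepth 100000 in
/-- `M-(i) ≥ 0` on the triangle `T = {0, 1, 4}`, pair `e = {1, 4}`. -/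
theorem cert_MI_014_14 :
    CertLE (kNegMI (triMask 0 1 4) (pairMask 1 4)) (kPosMI (triMask 0 1 4) (pairMask 1 4)) := by
  unfold CertLE
  decide +kernel

set_option maxRecDepth 100000 in
/-- `M-(i) ≥ 0` on the triangle `T = {0, 2, 3}`, pair `e = {0, 2}`. -/
theorem cert_MI_023_02 :
    CertLE (kNegMI (triMask 0 2 3) (pairMask 0 2)) (kPosMI (triMask 0 2 3) (pairMask 0 2)) := by
  unfold CertLE
  decide +kernel

set_option maxRecDepth 100000 in
/-- `M-(i) ≥ 0` on the triangle `T = {0, 2, 3}`, pair `e = {0, 3}`. -/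
theorem cert_MI_023_03 :
    CertLE (kNegMI (triMask 0 2 3) (pairMask 0 3)) (kPosMI (triMask 0 2 3) (pairMask 0 3)) := by
  unfold CertLE
  decide +kernel

set_option maxRecDepth 100000 in
/-- `M-(i) ≥ 0` on the triangle `T = {0, 2, 3}`, pair `e = {2, 3}`. -/
theorem cert_MI_023_23 :
    CertLE (kNegMI (triMask 0 2 3) (pairMask 2 3)) (kPosMI (triMask 0 2 3) (pairMask 2 3)) := by
  unfold CertLE
  decide +kernel

end K5

end Summit.Ventures.PercRepro2
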